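import Summits.Ventures.HodgeRepro.CMHodgeOn

/-!
# The `G`-set model in eigen-coordinates: the lex-ordered wedge basis of `⋀^n ℂ^{Fin n × G}`, the two blocks of a
product and the `σ`-lines as basis vectors

Blind re-derivation cell `pub-hodge-repro`, seat `night-3` (gen 4).  Imports typer-2's `CMHodgeOn` (coordinate vectors
`coordVecOn`, coordinate wedges `coordWedgeOn` on `⋀[ℂ]^n (X → ℂ)`).  Namespace `HodgeRepro.Night3.GSetModel`.

The route's dictionary side models the cohomology of a corner product `B = ∏_{i < n} A_{T_i}` of `n` CM abelian
varieties of one Galois CM field `F` (Galois group `G` = the embeddings) in eigen-coordinates: `H¹(B) ⊗ ℂ = ℂ^{Fin n × G}`,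
`(i, σ) ↦` the `σ`-eigenline of the `i`-th factor (Deligne LNM 900 Ex. 3.7; typer-2 `splitEquiv`), and the degree where the
Weil space lives is `H^n(B, ℂ) = ⋀^n ℂ^{Fin n × G}` (`Hn G n`).  This file is the bookkeeping for night-3's concrete
Künneth map (`Night3GSetKunneth`):

* the two blocks `inl : Fin n × G → Fin (n + k) × G` / `inr : Fin k × G → Fin (n + k) × G` of a product of `n` and `k`
  factors, the index set `lineSet n σ = {(i, σ) : i < n}` of the `σ`-line, the block embeddings `inlEmb` / `inrEmb` of the
  lex-ordered index sets and the unions `blocksUnion` (`lineSet_add`: the line set of `n + k` factors is the union of the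
  line sets of the blocks);
* `line n σ = coordWedgeOn n (i ↦ (i, σ))` — the `σ`-line wedge `e_{(0,σ)} ∧ ⋯ ∧ e_{(n−1,σ)}` (night-1's `weilWedgeProd`
  with the identity enumeration); the extensions by zero `inlMap` / `inrMap` of `ℂ^{Fin n × G}`, `ℂ^{Fin k × G}` into
  `ℂ^{Fin (n + k) × G}`; the block parts `block₁ S`, `block₂ S` of a set `S ⊆ Fin (n + k) × G`;
* the lex order on `Fin n × G` (factor index first; any linear order on `G`): `inlEmb`, `inrEmb` strictly monotone,
  every element of block 1 precedes every element of block 2 (`inlEmb_lt_inrEmb`), the increasing enumeration of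
  `lineSet n σ` is `i ↦ (i, σ)` (`ofFinEmbEquiv_symm_lineSet`);
* `lexBasis n` — the coordinate basis of `ℂ^{Fin n × G}` indexed by `Lex (Fin n × G)`; `wedgeBasis n` — Mathlib's
  exterior-power basis `e_S = e_{s₀} ∧ ⋯ ∧ e_{s_{n−1}}` (`S` in increasing lex order); and **`wedgeBasis_lineSet`**:
  `e_{lineSet n σ} = line n σ` — the `σ`-line IS a basis vector, with sign `+1`.

Nothing geometric is built; nothing here says anything about the status of the Hodge conjecture for CM abelian
varieties, which is NOT proved.
-/

set_option autoImplicit false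

open Finset Module
open scoped TensorProduct

namespace HodgeRepro.Night3.GSetModel

open HodgeRepro.CMHodgeOn

/-- The eigen-coordinate space `ℂ^{Fin n × G}` of `H¹(B, ℂ)` for `n` factors. -/
abbrev V (G : Type*) (n : ℕ) : Type _ := (Fin n × G) → ℂ

/-- `H^n(B, ℂ) = ⋀^n ℂ^{Fin n × G}`, the degree of the Weil space of an `n`-fold corner product. -/
abbrev Hn (G : Type*) (n : ℕ) : Type _ := ⋀[ℂ]^n (V G n)

/-! ### The two blocks of `Fin (n + k) × G`, the line index sets (no instances on `G`) -/

section Plain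

variable {G : Type*}

/-- Block 1: `(i, σ) ↦ (castAdd k i, σ)`. -/
def inl (n k : ℕ) (x : Fin n × G) : Fin (n + k) × G := (Fin.castAdd k x.1, x.2)

/-- Block 2: `(j, σ) ↦ (natAdd n j, σ)`. -/
def inr (n k : ℕ) (x : Fin k × G) : Fin (n + k) × G := (Fin.natAdd n x.1, x.2)

/-- `inl` is injective. -/
theorem inl_injective (n k : ℕ) : Function.Injective (inl (G := G) n k) := by
  rintro ⟨i, σ⟩ ⟨j, τ⟩ h
  simp only [inl, Prod.mk.injEq] at h
  exact Prod.ext (Fin.castAdd_injective n k h.1) h.2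

/-- `inr` is injective. -/
theorem inr_injective (n k : ℕ) : Function.Injective (inr (G := G) n k) := by
  rintro ⟨i, σ⟩ ⟨j, τ⟩ h
  simp only [inr, Prod.mk.injEq] at h
  exact Prod.ext (Fin.natAdd_injective k n h.1) h.2

/-- The embedding `i ↦ (i, σ)` into the lex-ordered index set. -/
def lineEmb (n : ℕ) (σ : G) : Fin n ↪ Lex (Fin n × G) :=
  ⟨fun i => toLex (i, σ), fun i j h => by simpa using congrArg (fun x => (ofLex x).1) h⟩

/-- The index set `{(i, σ) : i < n}` of the `σ`-line, as an `n`-element set. -/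
def lineSet (n : ℕ) (σ : G) : Set.powersetCard (Lex (Fin n × G)) n :=
  ⟨(univ : Finset (Fin n)).map (lineEmb n σ), by simp [Set.powersetCard.mem_iff]⟩

/-- Membership in the `σ`-line set: the second coordinate is `σ`. -/
theorem mem_lineSet_iff (n : ℕ) (σ : G) (x : Lex (Fin n × G)) :
    x ∈ (lineSet n σ : Finset (Lex (Fin n × G))) ↔ (ofLex x).2 = σ := by
  simp only [lineSet, mem_map, mem_univ, true_and, lineEmb, Function.Embedding.coeFn_mk]
  constructor
  · rintro ⟨i, rfl⟩; rfl
  · intro h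
    exact ⟨(ofLex x).1, by rw [← h]; rfl⟩

/-- Block 1 as an embedding of the lex-ordered index sets. -/
def inlEmb (n k : ℕ) : Lex (Fin n × G) ↪ Lex (Fin (n + k) × G) :=
  ⟨fun x => toLex (inl n k (ofLex x)), fun _ _ h => inl_injective n k (toLex.injective h)⟩

/-- Block 2 as an embedding of the lex-ordered index sets. -/
def inrEmb (n k : ℕ) : Lex (Fin k × G) ↪ Lex (Fin (n + k) × G) :=
  ⟨fun x => toLex (inr n k (ofLex x)), fun _ _ h => inr_injective n k (toLex.injective h)⟩

/-- The two blocks are disjoint. -/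
theorem inlEmb_ne_inrEmb (n k : ℕ) (x : Lex (Fin n × G)) (y : Lex (Fin k × G)) :
    inlEmb n k x ≠ inrEmb n k y := by
  intro h
  have h1 : (Fin.castAdd k (ofLex x).1).val = (Fin.natAdd n (ofLex y).1).val :=
    congrArg (fun z => ((ofLex z).1 : ℕ)) h
  rw [Fin.val_castAdd, Fin.val_natAdd] at h1
  have := (ofLex x).1.isLt
  omega

/-- Every index lies in block 1 or in block 2. -/
theorem exists_inlEmb_or_inrEmb (n k : ℕ) (z : Lex (Fin (n + k) × G)) :
    (∃ x, inlEmb n k x = z) ∨ ∃ y, inrEmb n k y = z := by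
  refine Fin.addCases (motive := fun i => (ofLex z).1 = i → (∃ x, inlEmb n k x = z) ∨ ∃ y, inrEmb n k y = z)
    (fun a h => Or.inl ⟨toLex (a, (ofLex z).2), ?_⟩) (fun b h => Or.inr ⟨toLex (b, (ofLex z).2), ?_⟩)
    (ofLex z).1 rfl
  · show toLex (Fin.castAdd k a, (ofLex z).2) = z
    rw [← h]; rfl
  · show toLex (Fin.natAdd n b, (ofLex z).2) = z
    rw [← h]; rfl

/-- A finset of known cardinality as an element of `Set.powersetCard`. -/
def toPC {I : Type*} {m : ℕ} (T : Finset I) (hT : T.card = m) : Set.powersetCard I m :=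
  ⟨T, Set.powersetCard.mem_iff.mpr hT⟩

/-- `toPC` is the identity on the underlying finset. -/
@[simp] theorem coe_toPC {I : Type*} {m : ℕ} (T : Finset I) (hT : T.card = m) :
    ((toPC T hT : Set.powersetCard I m) : Finset I) = T := rfl

end Plain

/-! ### The `σ`-lines and the extensions by zero (`DecidableEq G`) -/

section Dec

variable {G : Type*} [DecidableEq G]

/-- The `σ`-line wedge `e_{(0,σ)} ∧ ⋯ ∧ e_{(n−1,σ)}` — night-1's `weilWedgeProd` with the identity enumeration. -/
noncomputable def line (n : ℕ) (σ : G) : Hn G n := coordWedgeOn n fun i : Fin n => (i, σ)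

/-- The extension by zero `ℂ^{Fin n × G} → ℂ^{Fin (n + k) × G}` along block 1. -/
noncomputable def inlMap (n k : ℕ) : V G n →ₗ[ℂ] V G (n + k) :=
  Function.ExtendByZero.linearMap ℂ (inl n k)

/-- The extension by zero `ℂ^{Fin k × G} → ℂ^{Fin (n + k) × G}` along block 2. -/
noncomputable def inrMap (n k : ℕ) : V G k →ₗ[ℂ] V G (n + k) :=
  Function.ExtendByZero.linearMap ℂ (inr n k)

/-- `inlMap` carries the coordinate vector of `x` to that of `inl x`. -/
theorem inlMap_coordVecOn (n k : ℕ) (x : Fin n × G) : inlMap n k (coordVecOn x) = coordVecOn (inl n k x) := by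
  funext z
  simp only [inlMap, Function.ExtendByZero.linearMap_apply]
  by_cases hz : ∃ x', inl n k x' = z
  · obtain ⟨x', rfl⟩ := hz
    rw [(inl_injective n k).extend_apply]
    simp only [coordVecOn_apply, (inl_injective n k).eq_iff]
  · rw [Function.extend_apply' _ _ _ hz, Pi.zero_apply, coordVecOn_apply, if_neg]
    exact fun h => hz ⟨x, h.symm⟩

/-- `inrMap` carries the coordinate vector of `y` to that of `inr y`. -/
theorem inrMap_coordVecOn (n k : ℕ) (y : Fin k × G) : inrMap n k (coordVecOn y) = coordVecOn (inr n k y) := by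
  funext z
  simp only [inrMap, Function.ExtendByZero.linearMap_apply]
  by_cases hz : ∃ y', inr n k y' = z
  · obtain ⟨y', rfl⟩ := hz
    rw [(inr_injective n k).extend_apply]
    simp only [coordVecOn_apply, (inr_injective n k).eq_iff]
  · rw [Function.extend_apply' _ _ _ hz, Pi.zero_apply, coordVecOn_apply, if_neg]
    exact fun h => hz ⟨y, h.symm⟩

/-- The union `inl S₁ ⊔ inr S₂` of a block-1 set and a block-2 set. -/
def blocksUnion (n k : ℕ) (S₁ : Finset (Lex (Fin n × G))) (S₂ : Finset (Lex (Fin k × G))) :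
    Finset (Lex (Fin (n + k) × G)) :=
  S₁.map (inlEmb n k) ∪ S₂.map (inrEmb n k)

/-- Membership in `blocksUnion`: the image of a member of `S₁` under `inlEmb` or of a member of `S₂` under `inrEmb`. -/
theorem mem_blocksUnion (n k : ℕ) (S₁ : Finset (Lex (Fin n × G))) (S₂ : Finset (Lex (Fin k × G)))
    (z : Lex (Fin (n + k) × G)) :
    z ∈ blocksUnion n k S₁ S₂ ↔ (∃ x ∈ S₁, inlEmb n k x = z) ∨ ∃ y ∈ S₂, inrEmb n k y = z := by
  simp [blocksUnion]

/-- The two blocks are disjoint, so the union has `|S₁| + |S₂|` elements. -/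
theorem card_blocksUnion (n k : ℕ) (S₁ : Finset (Lex (Fin n × G))) (S₂ : Finset (Lex (Fin k × G))) :
    (blocksUnion n k S₁ S₂).card = S₁.card + S₂.card := by
  rw [blocksUnion, card_union_of_disjoint, card_map, card_map]
  rw [Finset.disjoint_left]
  intro z hz hz'
  obtain ⟨x, _, rfl⟩ := mem_map.mp hz
  obtain ⟨y, _, hy⟩ := mem_map.mp hz'
  exact inlEmb_ne_inrEmb n k x y hy.symm

/-- The union of an `n`-set in block 1 and a `k`-set in block 2 is an `(n + k)`-set. -/
def blocksUnionPC (n k : ℕ) (S₁ : Set.powersetCard (Lex (Fin n × G)) n) (S₂ : Set.powersetCard (Lex (Fin k × G)) k) :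
    Set.powersetCard (Lex (Fin (n + k) × G)) (n + k) :=
  toPC (blocksUnion n k S₁ S₂) (by rw [card_blocksUnion, S₁.prop, S₂.prop])

/-- The `σ`-line set of `n + k` factors is the union of the `σ`-line sets of the two blocks. -/
theorem lineSet_add (n k : ℕ) (σ : G) :
    lineSet (n + k) σ = blocksUnionPC n k (lineSet n σ) (lineSet k σ) := by
  refine Subtype.ext (Finset.ext fun z => ?_)
  rw [mem_lineSet_iff, blocksUnionPC, coe_toPC, mem_blocksUnion]
  constructor
  · intro hz
    rcases exists_inlEmb_or_inrEmb n k z with ⟨x, rfl⟩ | ⟨y, rfl⟩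
    · exact Or.inl ⟨x, (mem_lineSet_iff n σ x).mpr hz, rfl⟩
    · exact Or.inr ⟨y, (mem_lineSet_iff k σ y).mpr hz, rfl⟩
  · rintro (⟨x, hx, rfl⟩ | ⟨y, hy, rfl⟩)
    · exact (mem_lineSet_iff n σ x).mp hx
    · exact (mem_lineSet_iff k σ y).mp hy

end Dec

/-! ### Blocks of a set, unions of block sets (`Fintype G`, `DecidableEq G`) -/

section DecFin

variable {G : Type*} [Fintype G] [DecidableEq G]

/-- The part of `S ⊆ Fin (n + k) × G` in block 1, read in `Fin n × G`. -/
def block₁ (n k : ℕ) (S : Finset (Lex (Fin (n + k) × G))) : Finset (Lex (Fin n × G)) :=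
  (univ : Finset (Lex (Fin n × G))).filter fun x => toLex (inl n k (ofLex x)) ∈ S

/-- The part of `S ⊆ Fin (n + k) × G` in block 2, read in `Fin k × G`. -/
def block₂ (n k : ℕ) (S : Finset (Lex (Fin (n + k) × G))) : Finset (Lex (Fin k × G)) :=
  (univ : Finset (Lex (Fin k × G))).filter fun x => toLex (inr n k (ofLex x)) ∈ S

/-- Membership in block 1 of `S`. -/
theorem mem_block₁ (n k : ℕ) (S : Finset (Lex (Fin (n + k) × G))) (x : Lex (Fin n × G)) :
    x ∈ block₁ n k S ↔ toLex (inl n k (ofLex x)) ∈ S := by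
  simp [block₁]

/-- Membership in block 2 of `S`. -/
theorem mem_block₂ (n k : ℕ) (S : Finset (Lex (Fin (n + k) × G))) (x : Lex (Fin k × G)) :
    x ∈ block₂ n k S ↔ toLex (inr n k (ofLex x)) ∈ S := by
  simp [block₂]

/-- The blocks of the `σ`-line set are the `σ`-line sets of the factors. -/
theorem block₁_lineSet (n k : ℕ) (σ : G) :
    block₁ n k (lineSet (n + k) σ : Finset (Lex (Fin (n + k) × G))) = lineSet n σ := by
  ext x
  rw [mem_block₁, mem_lineSet_iff, mem_lineSet_iff]
  rfl

/-- Block 2 of the `σ`-line set of `n + k` factors is the `σ`-line set of `k` factors. -/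
theorem block₂_lineSet (n k : ℕ) (σ : G) :
    block₂ n k (lineSet (n + k) σ : Finset (Lex (Fin (n + k) × G))) = lineSet k σ := by
  ext x
  rw [mem_block₂, mem_lineSet_iff, mem_lineSet_iff]
  rfl

/-- Block 1 of `inl S₁ ⊔ inr S₂` is `S₁`. -/
theorem block₁_blocksUnion (n k : ℕ) (S₁ : Finset (Lex (Fin n × G))) (S₂ : Finset (Lex (Fin k × G))) :
    block₁ n k (blocksUnion n k S₁ S₂) = S₁ := by
  ext x
  rw [mem_block₁, mem_blocksUnion]
  constructor
  · rintro (⟨x', hx', h⟩ | ⟨y, _, h⟩)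
    · rwa [← (inlEmb n k).injective (h.trans rfl)]
    · exact absurd h.symm (inlEmb_ne_inrEmb n k x y)
  · intro hx
    exact Or.inl ⟨x, hx, rfl⟩

/-- Block 2 of `inl S₁ ⊔ inr S₂` is `S₂`. -/
theorem block₂_blocksUnion (n k : ℕ) (S₁ : Finset (Lex (Fin n × G))) (S₂ : Finset (Lex (Fin k × G))) :
    block₂ n k (blocksUnion n k S₁ S₂) = S₂ := by
  ext y
  rw [mem_block₂, mem_blocksUnion]
  constructor
  · rintro (⟨x, _, h⟩ | ⟨y', hy', h⟩)
    · exact absurd h (inlEmb_ne_inrEmb n k x y)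
    · rwa [← (inrEmb n k).injective (h.trans rfl)]
  · intro hy
    exact Or.inr ⟨y, hy, rfl⟩

/-- The coordinate basis of `ℂ^{Fin n × G}`, indexed by `Lex (Fin n × G)` (factor index first). -/
noncomputable def lexBasis (n : ℕ) : Basis (Lex (Fin n × G)) ℂ (V G n) :=
  (Pi.basisFun ℂ (Fin n × G)).reindex toLex

/-- `lexBasis n x` is the coordinate vector `e_x`. -/
theorem lexBasis_apply (n : ℕ) (x : Lex (Fin n × G)) : lexBasis n x = coordVecOn (ofLex x) := by
  simp [lexBasis, Basis.reindex_apply, Pi.basisFun_apply, coordVecOn]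

end DecFin

/-! ### The lex order on the index sets (`LinearOrder G`) -/

section Ord

variable {G : Type*} [LinearOrder G]

/-- `i ↦ (i, σ)` is strictly monotone for the lex order (the first coordinates increase). -/
theorem strictMono_lineEmb (n : ℕ) (σ : G) : StrictMono fun i : Fin n => toLex (i, σ) := by
  intro i j hij
  exact Prod.Lex.lt_iff.mpr (Or.inl hij)

/-- Block 1 is strictly monotone for the lex order. -/
theorem strictMono_inlEmb (n k : ℕ) : StrictMono (inlEmb (G := G) n k) := by
  intro x y hxy
  show toLex (inl n k (ofLex x)) < toLex (inl n k (ofLex y))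
  rcases Prod.Lex.lt_iff.mp hxy with h | ⟨h1, h2⟩
  · exact Prod.Lex.lt_iff.mpr (Or.inl (Fin.strictMono_castAdd k h))
  · exact Prod.Lex.lt_iff.mpr (Or.inr ⟨congrArg (Fin.castAdd k) h1, h2⟩)

/-- Block 2 is strictly monotone for the lex order. -/
theorem strictMono_inrEmb (n k : ℕ) : StrictMono (inrEmb (G := G) n k) := by
  intro x y hxy
  show toLex (inr n k (ofLex x)) < toLex (inr n k (ofLex y))
  rcases Prod.Lex.lt_iff.mp hxy with h | ⟨h1, h2⟩
  · exact Prod.Lex.lt_iff.mpr (Or.inl (Fin.strictMono_natAdd n h))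
  · exact Prod.Lex.lt_iff.mpr (Or.inr ⟨congrArg (Fin.natAdd n) h1, h2⟩)

/-- Every element of block 1 precedes every element of block 2 in the lex order. -/
theorem inlEmb_lt_inrEmb (n k : ℕ) (x : Lex (Fin n × G)) (y : Lex (Fin k × G)) :
    inlEmb n k x < inrEmb n k y := by
  show toLex (inl n k (ofLex x)) < toLex (inr n k (ofLex y))
  refine Prod.Lex.lt_iff.mpr (Or.inl ?_)
  show Fin.castAdd k (ofLex x).1 < Fin.natAdd n (ofLex y).1
  rw [Fin.lt_def, Fin.val_castAdd, Fin.val_natAdd]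
  have := (ofLex x).1.isLt
  omega

/-- The increasing enumeration of the line set is `i ↦ (i, σ)`. -/
theorem ofFinEmbEquiv_symm_lineSet (n : ℕ) (σ : G) :
    ⇑(Set.powersetCard.ofFinEmbEquiv.symm (lineSet n σ)) = fun i : Fin n => toLex (i, σ) := by
  rw [Set.powersetCard.ofFinEmbEquiv_symm_apply]
  refine (Finset.orderEmbOfFin_unique (lineSet n σ).prop (fun i => ?_) (strictMono_lineEmb n σ)).symm
  exact (mem_lineSet_iff n σ _).mpr rfl

end Ord

/-! ### The lex-ordered wedge basis; the lines as basis vectors -/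

section Basis

variable {G : Type*} [Fintype G] [DecidableEq G] [LinearOrder G]

/-- The basis `e_S` (`S ⊆ Fin n × G`, `|S| = n`, wedged in increasing lex order) of `⋀^n ℂ^{Fin n × G}`. -/
noncomputable def wedgeBasis (n : ℕ) : Basis (Set.powersetCard (Lex (Fin n × G)) n) ℂ (Hn G n) :=
  (lexBasis n).exteriorPower n

/-- `wedgeBasis n S` is the wedge of the coordinate vectors of `S` in increasing lex order. -/
theorem wedgeBasis_apply (n : ℕ) (S : Set.powersetCard (Lex (Fin n × G)) n) :
    wedgeBasis n S = exteriorPower.ιMulti ℂ n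
      (fun i => coordVecOn (ofLex (Set.powersetCard.ofFinEmbEquiv.symm S i))) := by
  rw [wedgeBasis, exteriorPower.basis_apply, exteriorPower.ιMulti_family]
  congr 1
  funext i
  exact lexBasis_apply n _

/-- **The line is a basis vector, with sign `+1`**: `e_{lineSet n σ} = line n σ`. -/
theorem wedgeBasis_lineSet (n : ℕ) (σ : G) : wedgeBasis n (lineSet n σ) = line n σ := by
  rw [wedgeBasis_apply, line, coordWedgeOn, ofFinEmbEquiv_symm_lineSet]
  rfl

end Basis

end HodgeRepro.Night3.GSetModel
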